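import Summits.HubbardSuperconductivity.HubbardSuperconductivity.Theorems.BalabanIRBirEveryGroundStateSocket
import Summits.HubbardSuperconductivity.HubbardSuperconductivity.Theorems.BalabanIRBirEveryGroundStatePencil
import Summits.HubbardSuperconductivity.HubbardSuperconductivity.Theses.BalabanIR

/-!
# Route `BalabanIR`, crux 5 `BirEveryGroundState` (`stmt-HubbardSuperconductivity-2083`):
# the crux is EQUIVALENT to its transfer form

`birEveryGroundState_iff_transfer`: `BirEveryGroundState` holds if and only if, for all data
`(δ, U₁, U₂, c)` of its hypothesis, the ground-state-AVERAGE bound on the window `(U₁, U₂)` yields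
ONE coupling `U` of the window, a constant `c' > 0` and a threshold `L₀` such that EVERY
normalised `(2⌊(1-δ)L²/2⌋, S^z = 0)`-sector ground state `ψ` of `hubbardTorus 2 L 1 U` at every even
side `L ≥ L₀` has `c' L⁴ ≤ re ⟨ψ, Δ_d† Δ_d ψ⟩` — an eventual uniform lower bound of order `L⁴` on the
BOTTOM eigenvalue of the compression of `Δ_d† Δ_d` to the sector ground eigenspace, where the
hypothesis bounds its AVERAGE eigenvalue at every coupling of the window. The direction ⇐ is the
Theses-free socket `birEveryGroundState_structural_of_transfer`; the direction ⇒ is the converse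
`groundState_bound_of_forall_hasLRO` (worst-ground-state sequences). So the transfer form is not a
convenient strengthening but THE crux, with `liminf`, boxes, pull-backs and admissible sequences
stripped: every mechanism for average → every (Kato–Schur genericity of irreducible ground
multiplets, ground-state uniqueness, κ-chord response, second moments; companion files
`BalabanIRBirEveryGroundState{,Schur,Closures,Moments,Residue,Samuelson}.lean`) is a way of
producing `(U, c', L₀)`, and nothing weaker can close the item.

`birEveryGroundState_of_avgToMin_at_nonexceptional` is the window-free, POINTWISE residual this
suggests: crux 5 follows as soon as, at every coupling `U > 0` that is non-exceptional for all sides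
(maximal number of distinct eigenvalues of `hubbardTorus 2 L 1 ·` at `U` for every `L`; such
couplings exist in every window, `exists_coupling_forall_card_roots_le_hubbardTorus`), an eventual
AVERAGE bound `c L⁴ re tr P ≤ re tr (P Δ_d† Δ_d)` upgrades to an eventual BOTTOM bound
`c' L⁴ ≤ re ⟨ψ, Δ_d† Δ_d ψ⟩` on the same ground eigenspaces — "no pair-dark ground state at a
non-exceptional coupling", weaker than the structural DarkPartnerExclusion `hdark` of
`BalabanIRBirEveryGroundStateResidue.lean` (scalar compressions), which implies it.

`exists_darkGroundStates_of_not_birEveryGroundState` spells out the shape of a counterexample: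
data `(δ, U₁, U₂, c)` satisfying the window-average hypothesis such that at EVERY coupling of the
window, for every `c' > 0`, there are normalised sector ground states with
`re ⟨ψ, Δ_d† Δ_d ψ⟩ < c' L⁴` at arbitrarily large even sides ("dark" ground states infinitely
often, everywhere in the window).

This file imports the route file (it names the decl) and is therefore a `--supports` helper which
no closing module may import (rev-5 materialisation rule); the closing socket lives in the
Theses-free module `BalabanIRBirEveryGroundStateSocket`. Scalapino, Phys. Rep. 250 (1995) 329, §2;
Kato (1966) II §6.1 for the context. Folklore; no definition is introduced.
-/

noncomputable section

namespace Summit.HubbardSuperconductivity.HubbardSuperconductivity.Theorems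

open Matrix Finset Filter
open Literature.Probability.LatticeModels Literature.MathematicalPhysics.QuantumLattice
open Summit.HubbardSuperconductivity.HubbardSuperconductivity.Theses.BalabanIR
open scoped ComplexOrder

/-- **Crux 5 ⇔ its transfer form.** `BirEveryGroundState` is equivalent to: for all
`δ ∈ (0, 1/2)`, `0 < U₁ < U₂`, `c > 0`, if the window-average hypothesis holds (for every
`U ∈ (U₁, U₂)`, eventually in even `L`, `c L⁴ re tr P ≤ re tr (P Δ_d† Δ_d)` with `P` the projection
onto the sector ground eigenspace), then at SOME `U ∈ (U₁, U₂)` there are `c' > 0` and `L₀` with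
`c' L⁴ ≤ re ⟨ψ, Δ_d† Δ_d ψ⟩` for every normalised sector ground state `ψ` at every even side
`L ≥ L₀`. (⇐: `birEveryGroundState_structural_of_transfer`; ⇒: apply the crux and convert its
conclusion at the produced coupling by `groundState_bound_of_forall_hasLRO`.)
Scalapino, Phys. Rep. 250 (1995) 329, §2 eq. (2.4); Friedli–Velenik (2017) §3.7.2. [folklore] -/
theorem birEveryGroundState_iff_transfer :
    BirEveryGroundState ↔
      ∀ (δ U₁ U₂ c : ℝ), δ ∈ Set.Ioo (0:ℝ) (1/2) → 0 < U₁ → U₁ < U₂ → 0 < c →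
        (∀ U ∈ Set.Ioo U₁ U₂, ∃ L₀ : ℕ, ∀ (L : ℕ) [NeZero L], L₀ ≤ L → Even L →
          let N : ℕ := 2 * ⌊(1 - δ) * (L : ℝ) ^ 2 / 2⌋₊
          let H := hubbardTorus 2 L 1 U
          let S := szSector (Λ := FermionTorus 2 L) N 0
          let E₀ := S ⊓ Module.End.eigenspace (Matrix.toLin' H) ((H.minEnergyOn S : ℝ) : ℂ)
          let P := projMatrix (E₀.map (Fock.toEuclidean (ι := Orb (FermionTorus 2 L)) :
            Fock (Orb (FermionTorus 2 L)) →ₗ[ℂ] EuclideanSpace ℂ (Finset (Orb (FermionTorus 2 L)))))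
          c * (L : ℝ) ^ 4 * P.trace.re ≤
            (P * ((pairField dWaveFormFactor L)ᴴ * pairField dWaveFormFactor L)).trace.re) →
        ∃ U ∈ Set.Ioo U₁ U₂, ∃ c' : ℝ, 0 < c' ∧ ∃ L₀ : ℕ, ∀ (L : ℕ) [NeZero L], L₀ ≤ L → Even L →
          ∀ ψ : Fock (Orb (FermionTorus 2 L)),
            IsGroundStateInSector (hubbardTorus 2 L 1 U) (2 * ⌊(1 - δ) * (L : ℝ) ^ 2 / 2⌋₊) 0 ψ →
            star ψ ⬝ᵥ ψ = 1 →
            c' * (L : ℝ) ^ 4 ≤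
              (star ψ ⬝ᵥ ((pairField dWaveFormFactor L)ᴴ * pairField dWaveFormFactor L) *ᵥ ψ).re := by
  constructor
  · intro h δ U₁ U₂ c hδ hU₁ hU₁₂ hc hyp
    obtain ⟨U, hU, hall⟩ := h δ U₁ U₂ c hδ hU₁ hU₁₂ hc hyp
    exact ⟨U, hU, groundState_bound_of_forall_hasLRO U δ (by linarith [hδ.1]) hall⟩
  · intro h
    exact birEveryGroundState_structural_of_transfer h

/-- **Crux 5 from the window-free, pointwise residual "average ⇒ bottom at non-exceptional
couplings".** Suppose that for every `δ ∈ (0, 1/2)`, every coupling `U > 0` which is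
non-exceptional for all sides `L` (the number of distinct eigenvalues of `hubbardTorus 2 L 1 ·` is
maximal at `U` for every `L`) and every `c > 0`: IF eventually in even `L` the ground-state average
bound `c L⁴ re tr P ≤ re tr (P Δ_d† Δ_d)` holds at `(U, L)`, THEN for some `c' > 0`, eventually in
even `L`, every normalised sector ground state at `(U, L)` has `c' L⁴ ≤ re ⟨ψ, Δ_d† Δ_d ψ⟩`. Then
`BirEveryGroundState`: every window contains a coupling non-exceptional for all `L`
(`exists_coupling_forall_card_roots_le_hubbardTorus`, finiteness of the exceptional couplings of an
affine Hermitian pencil), the window hypothesis supplies the average bound there, and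
`birEveryGroundState_iff_transfer` concludes. The hypothesis is implied by the structural
DarkPartnerExclusion of `birEveryGroundState_of_darkPartnerExclusion` (scalar ground compressions:
bottom = average) and is NOT proved here. Kato (1966) II §1.1, §6.1; Scalapino (1995) §2.
[folklore] -/
theorem birEveryGroundState_of_avgToMin_at_nonexceptional
    (h : ∀ δ ∈ Set.Ioo (0:ℝ) (1/2), ∀ U : ℝ, 0 < U →
      (∀ (L : ℕ) (u' : ℝ), (hubbardTorus 2 L 1 u').charpoly.roots.toFinset.card ≤
        (hubbardTorus 2 L 1 U).charpoly.roots.toFinset.card) →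
      ∀ c : ℝ, 0 < c →
      (∃ L₀ : ℕ, ∀ (L : ℕ) [NeZero L], L₀ ≤ L → Even L →
        let N : ℕ := 2 * ⌊(1 - δ) * (L : ℝ) ^ 2 / 2⌋₊
        let H := hubbardTorus 2 L 1 U
        let S := szSector (Λ := FermionTorus 2 L) N 0
        let E₀ := S ⊓ Module.End.eigenspace (Matrix.toLin' H) ((H.minEnergyOn S : ℝ) : ℂ)
        let P := projMatrix (E₀.map (Fock.toEuclidean (ι := Orb (FermionTorus 2 L)) :
          Fock (Orb (FermionTorus 2 L)) →ₗ[ℂ] EuclideanSpace ℂ (Finset (Orb (FermionTorus 2 L)))))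
        c * (L : ℝ) ^ 4 * P.trace.re ≤
          (P * ((pairField dWaveFormFactor L)ᴴ * pairField dWaveFormFactor L)).trace.re) →
      ∃ c' : ℝ, 0 < c' ∧ ∃ L₀ : ℕ, ∀ (L : ℕ) [NeZero L], L₀ ≤ L → Even L →
        ∀ ψ : Fock (Orb (FermionTorus 2 L)),
          IsGroundStateInSector (hubbardTorus 2 L 1 U) (2 * ⌊(1 - δ) * (L : ℝ) ^ 2 / 2⌋₊) 0 ψ →
          star ψ ⬝ᵥ ψ = 1 →
          c' * (L : ℝ) ^ 4 ≤
            (star ψ ⬝ᵥ ((pairField dWaveFormFactor L)ᴴ * pairField dWaveFormFactor L) *ᵥ ψ).re) :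
    BirEveryGroundState := by
  rw [birEveryGroundState_iff_transfer]
  intro δ U₁ U₂ c hδ hU₁ hU₁₂ hc hyp
  obtain ⟨U, hU, hmax⟩ := exists_coupling_forall_card_roots_le_hubbardTorus hU₁₂
  obtain ⟨c', hc', L₀, hL₀⟩ := h δ hδ U (hU₁.trans hU.1) hmax c hc (hyp U hU)
  exact ⟨U, hU, c', hc', L₀, fun L _ hL hLe => hL₀ L hL hLe⟩

/-- **The shape of a counterexample to crux 5.** If `BirEveryGroundState` fails, there are
`δ ∈ (0, 1/2)`, `0 < U₁ < U₂` and `c > 0` such that the window-average hypothesis holds on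
`(U₁, U₂)` and yet at EVERY coupling `U` of the window, for every `c' > 0` and every threshold
`L₀`, some even side `L ≥ L₀` carries a normalised sector ground state `ψ` with
`re ⟨ψ, Δ_d† Δ_d ψ⟩ < c' L⁴`: pair-"dark" ground states infinitely often in `L`, everywhere in the
window, coexisting with a window-wide average of order `L⁴` (hence, at the same sides, with
"bright" ground states of comparable multiplicity). This is the target a refutation must hit; the
hypothesis clause is the open ground-state-average LRO statement, so no instance is known.
(Contrapositive bookkeeping of `birEveryGroundState_iff_transfer`.) [folklore] -/
theorem exists_darkGroundStates_of_not_birEveryGroundState (h : ¬ BirEveryGroundState) :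
    ∃ δ U₁ U₂ c : ℝ, δ ∈ Set.Ioo (0:ℝ) (1/2) ∧ 0 < U₁ ∧ U₁ < U₂ ∧ 0 < c ∧
      (∀ U ∈ Set.Ioo U₁ U₂, ∃ L₀ : ℕ, ∀ (L : ℕ) [NeZero L], L₀ ≤ L → Even L →
        let N : ℕ := 2 * ⌊(1 - δ) * (L : ℝ) ^ 2 / 2⌋₊
        let H := hubbardTorus 2 L 1 U
        let S := szSector (Λ := FermionTorus 2 L) N 0
        let E₀ := S ⊓ Module.End.eigenspace (Matrix.toLin' H) ((H.minEnergyOn S : ℝ) : ℂ)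
        let P := projMatrix (E₀.map (Fock.toEuclidean (ι := Orb (FermionTorus 2 L)) :
          Fock (Orb (FermionTorus 2 L)) →ₗ[ℂ] EuclideanSpace ℂ (Finset (Orb (FermionTorus 2 L)))))
        c * (L : ℝ) ^ 4 * P.trace.re ≤
          (P * ((pairField dWaveFormFactor L)ᴴ * pairField dWaveFormFactor L)).trace.re) ∧
      ∀ U ∈ Set.Ioo U₁ U₂, ∀ c' : ℝ, 0 < c' → ∀ L₀ : ℕ, ∃ (L : ℕ) (_ : NeZero L), L₀ ≤ L ∧ Even L ∧
        ∃ ψ : Fock (Orb (FermionTorus 2 L)),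
          IsGroundStateInSector (hubbardTorus 2 L 1 U) (2 * ⌊(1 - δ) * (L : ℝ) ^ 2 / 2⌋₊) 0 ψ ∧
          star ψ ⬝ᵥ ψ = 1 ∧
          (star ψ ⬝ᵥ ((pairField dWaveFormFactor L)ᴴ * pairField dWaveFormFactor L) *ᵥ ψ).re <
            c' * (L : ℝ) ^ 4 := by
  rw [birEveryGroundState_iff_transfer] at h
  push Not at h
  obtain ⟨δ, U₁, U₂, c, hδ, hU₁, hU₁₂, hc, hyp, hdark⟩ := h
  refine ⟨δ, U₁, U₂, c, hδ, hU₁, hU₁₂, hc, hyp, fun U hU c' hc' L₀ => ?_⟩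
  obtain ⟨L, hL, hL₀, hev, ψ, hgs, hunit, hlt⟩ := hdark U hU c' hc' L₀
  exact ⟨L, hL, hL₀, hev, ψ, hgs, hunit, hlt⟩

end Summit.HubbardSuperconductivity.HubbardSuperconductivity.Theorems
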